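import Literature.AnabelianGeometry.SemiGraphs.ProSigmaCompletionModels
import Mathlib.Topology.Algebra.Group.Basic
import HarnessLib

/-!
# [IUTchI] §2 plumbing: functoriality of `F ↦ F̂` across universes; `Ĝ` is SLIM for an orientable
# surface group `G`

Mochizuki, *Inter-universal Teichmüller theory I*, kurims manuscript (May 2020), §2, Lemma 2.7 (v)–(vii),
pp. 57–59 [cite: Mochizuki2012, Lem 2.7(vi) p.59] (D-0012 claim key, status disputed — the content of this
file is plain profinite group theory and takes no side).  Proof-only companion of the §2 plumbing files
`ProfiniteCompletionQuotients.lean` / `ProfiniteCompletionSubgroups.lean`; it supplies the two pieces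
the PRINTED proof of Lemma 2.7 (vi) needs beyond what the tree already has:

* **functoriality of the profinite completion ACROSS UNIVERSES** (`exists_map_comp_toCompletion`): a
  homomorphism `f : A → B` of discrete groups living in DIFFERENT universes (the case of interest:
  `ℤ → K`, `K → ℤ` for `K : Type u`, whose completions `ℤ̂ = ZHat : Type 0` and `K̂ : Type u` Mathlib's
  functor `ProfiniteGrp.profiniteCompletion` cannot relate) induces a continuous homomorphism
  `F : Â → B̂` with `F ∘ η_A = η_B ∘ f`, built by hand on compatible families; uniqueness of such `F`
  (`eq_of_forall_apply_toCompletion_eq`, density of `η_A`) gives all composition laws; and a continuous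
  homomorphism out of `Â` maps into the closure of any set containing the images of `η_A(A)`
  (`apply_mem_closure_of_forall`);
* **the profinite completion of an orientable surface group is SLIM** (centralisers of open subgroups
  are trivial), UNCONDITIONALLY (`isSlimGroup_profiniteCompletion_of_surface`): abc-iut-w5-d116's model
  theorem `IsProSigmaCompletion.isProSigmaCompletion_toCompletion` (Mathlib's `Ĝ` is a pro-`Σ` completion
  in the sense of abc-iut-L3's [SemiAnbd] interface) transported along `G ≅ S_g` by the source-side
  transport `isProSigmaCompletion_comp_mulEquiv` proved here, fed into abc-iut-w5-d116's
  `IsProSigmaCompletion.isSlimGroup_of_oneRelator` ([AbsAnab] Lemma 1.3.1: pro-`Σ` completions of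
  one-relator groups on `≥ 4` generators are slim; `S_g` has `2g ≥ 4` generators).

Theorems only; no statement of the tree is restated.
-/

namespace Literature.IUT.HodgeTheaters.ProfiniteCompletion

open CategoryTheory ProfiniteGrp ProfiniteGrp.ProfiniteCompletion Topology

universe u v w

section Functorial

variable {A : Type u} [Group A] {B : Type v} [Group B]

/-- **Functoriality of the profinite completion, across universes.**  A homomorphism `f : A → B` of
discrete groups induces a continuous homomorphism `F : Â → B̂` with `F (η_A a) = η_B (f a)`: the
`N`-component of `F x` (`N ⊴ B` of finite index) is the image of the `f⁻¹(N)`-component of `x` under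
`A / f⁻¹(N) → B / N`.  (Mathlib's `ProfiniteGrp.profiniteCompletion.map` is the same map when `A`, `B`
live in one universe; the [IUTchI] §2 files need `ℤ → K` and `K → ℤ` with `K : Type u`, `ℤ : Type`.)
[cite: Mochizuki2012, Lem 2.7(vi) p.59] -/
theorem exists_map_comp_toCompletion (f : A →* B) :
    ∃ F : profiniteCompletion A →* profiniteCompletion B, Continuous F ∧
      ∀ a : A, F (toCompletion A a) = toCompletion B (f a) := by
  classical
  -- push the `f⁻¹(N)`-component forward along `A / f⁻¹(N) → B / N`
  let q : ∀ N : FiniteIndexNormalSubgroup B,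
      (diagram (GrpCat.of A)).obj (N.comap f) →* (diagram (GrpCat.of B)).obj N := fun N =>
    QuotientGroup.map (N.comap f).toSubgroup N.toSubgroup f le_rfl
  let c : profiniteCompletion A → ∀ N : FiniteIndexNormalSubgroup B, (diagram (GrpCat.of B)).obj N :=
    fun x N => q N (x.val (N.comap f))
  have hc : ∀ (x : profiniteCompletion A) (N : FiniteIndexNormalSubgroup B) (a : A),
      x.val (N.comap f) = QuotientGroup.mk a →
        c x N = (QuotientGroup.mk (f a) : B ⧸ N.toSubgroup) := by
    intro x N a ha
    change q N (x.val (N.comap f)) = _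
    rw [ha]
    rfl
  -- coherence of the family `c x`
  have hcoh : ∀ (x : profiniteCompletion A) ⦃N M : FiniteIndexNormalSubgroup B⦄ (π : N ⟶ M),
      (diagram (GrpCat.of B)).map π (c x N) = c x M := by
    intro x N M π
    obtain ⟨a, ha⟩ := QuotientGroup.mk_surjective (x.val (N.comap f))
    have hM : x.val (M.comap f) = QuotientGroup.mk a :=
      val_mk_eq_of_le x (FiniteIndexNormalSubgroup.comap_mono f π.le) a ha.symm
    rw [hc x N a ha.symm, hc x M a hM]
    rfl
  let Fx : profiniteCompletion A → profiniteCompletion B := fun x => ⟨fun N => c x N, hcoh x⟩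
  have hFx : ∀ x N, (Fx x).val N = c x N := fun _ _ => rfl
  let F : profiniteCompletion A →* profiniteCompletion B :=
    { toFun := Fx
      map_one' := by
        refine ProfiniteGrp.limit_ext _ _ _ fun N => ?_
        rw [hFx, hc 1 N 1 rfl, map_one]
        rfl
      map_mul' := fun x y => by
        refine ProfiniteGrp.limit_ext _ _ _ fun N => ?_
        change q N ((x * y).val (N.comap f)) = q N (x.val (N.comap f)) * q N (y.val (N.comap f))
        exact map_mul (q N) (x.val (N.comap f)) (y.val (N.comap f)) }
  refine ⟨F, ?_, fun a => ?_⟩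
  · -- continuity: each component is `(A / f⁻¹N → B / N) ∘ (x ↦ x_{f⁻¹N})` with discrete source
    refine continuous_induced_rng.2 (continuous_pi fun N => ?_)
    haveI : DiscreteTopology ((diagram (GrpCat.of A)).obj (N.comap f)) := ⟨rfl⟩
    exact (continuous_of_discreteTopology (f := (q N : _ → _))).comp (continuous_val (N.comap f))
  · refine ProfiniteGrp.limit_ext _ _ _ fun N => ?_
    change (Fx (toCompletion A a)).val N = _
    rw [hFx, hc (toCompletion A a) N a rfl]
    rfl

/-- **Uniqueness**: two continuous homomorphisms `Â → B̂` that agree on `η_A(A)` are equal (`η_A` has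
dense image, `B̂` is Hausdorff). [cite: Mochizuki2012, Lem 2.7(vi) p.59] -/
theorem eq_of_forall_apply_toCompletion_eq {F F' : profiniteCompletion A →* profiniteCompletion B}
    (hF : Continuous F) (hF' : Continuous F')
    (h : ∀ a : A, F (toCompletion A a) = F' (toCompletion A a)) : F = F' :=
  MonoidHom.ext fun x =>
    congrFun ((denseRange (GrpCat.of A)).equalizer hF hF' (funext fun a => h a)) x

/-- A continuous homomorphism out of `Â` takes values in the closure of any set that contains the
images of the dense subgroup `η_A(A)`. [cite: Mochizuki2012, Lem 2.7(vi) p.59] -/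
theorem apply_mem_closure_of_forall {P : Type w} [TopologicalSpace P]
    {F : profiniteCompletion A → P} (hF : Continuous F) {s : Set P}
    (h : ∀ a : A, F (toCompletion A a) ∈ s) (x : profiniteCompletion A) : F x ∈ closure s := by
  have hd : DenseRange (toCompletion A) := denseRange (GrpCat.of A)
  have h1 : F x ∈ F '' closure (Set.range (toCompletion A)) :=
    ⟨x, by rw [hd.closure_range]; exact Set.mem_univ x, rfl⟩
  refine closure_mono ?_ (image_closure_subset_closure_image hF h1)
  rintro _ ⟨_, ⟨a, rfl⟩, rfl⟩
  exact h a

end Functorial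

/-! ### Slimness of `Ĝ` for an orientable surface group `G` -/

section Slim

open Literature.AnabelianGeometry.SemiGraphs.SemiGraphOfAnabelioids

/-- **Transport of `IsProSigmaCompletion` along an isomorphism of the SOURCE group**: if `ι : Γ → P`
exhibits `P` as the pro-`Σ` completion of `Γ` and `e : Γ' ≃* Γ`, then so does `ι ∘ e : Γ' → P` (same
image; a normal `N ⊴ Γ'` of `Σ`-index corresponds to `e(N) ⊴ Γ` of the same index).  Companion of
abc-iut-L3's target-side `IsProSigmaCompletion.of_target_mulEquiv`.
[cite: MochizukiSemiAnbd2006, Ex. 2.10 p.31] -/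
theorem isProSigmaCompletion_comp_mulEquiv {Sigma : Set ℕ} {Γ : Type u} [Group Γ] {Γ' : Type v}
    [Group Γ'] {P : Type w} [Group P] [TopologicalSpace P] {ι : Γ →* P}
    (hι : IsProSigmaCompletion Sigma ι) (e : Γ' ≃* Γ) :
    IsProSigmaCompletion Sigma (ι.comp e.toMonoidHom) where
  dense := by
    have hr : Set.range (ι.comp e.toMonoidHom) = Set.range ι := by
      rw [MonoidHom.coe_comp, MulEquiv.coe_toMonoidHom, e.surjective.range_comp]
    rw [hr]
    exact hι.dense
  index_open := hι.index_open
  comap_surj N hNn hN := by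
    haveI := hNn
    haveI : (N.comap e.symm.toMonoidHom).Normal := Subgroup.Normal.comap hNn _
    have hidx : (N.comap e.symm.toMonoidHom).index = N.index :=
      Subgroup.index_comap_of_surjective _ e.symm.surjective
    obtain ⟨U, hUo, hU⟩ := hι.comap_surj (N.comap e.symm.toMonoidHom) inferInstance (hidx ▸ hN)
    refine ⟨U, hUo, ?_⟩
    ext x
    rw [Subgroup.mem_comap, MonoidHom.comp_apply, MulEquiv.coe_toMonoidHom, ← Subgroup.mem_comap, hU,
      Subgroup.mem_comap, MulEquiv.coe_toMonoidHom, e.symm_apply_apply]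

variable (G : Type u) [Group G]

/-- **The profinite completion of an orientable surface group is SLIM** — UNCONDITIONALLY: `G ≅ S_g`
(`g ≥ 2`) is a one-relator group on `2g ≥ 4` generators (`Fin g ⊕ Fin g`, relator `∏ [aᵢ, bᵢ]`), `η ∘ e⁻¹`
exhibits `Ĝ` as its pro-`Σ` completion for `Σ = {primes}` (abc-iut-w5-d116's
`isProSigmaCompletion_toCompletion` transported along `e`), and pro-`Σ` completions of one-relator groups
on `≥ 4` generators are slim (abc-iut-w5-d116's `isSlimGroup_of_oneRelator`, [AbsAnab] Lemma 1.3.1): the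
centraliser in `Ĝ` of every open subgroup is trivial. [cite: MochizukiAbsAnab2004, Lemma 1.3.1 p.15] -/
theorem isSlimGroup_profiniteCompletion_of_surface (hG : IsOrientableSurfaceGroup G) :
    Literature.AlgebraicGeometry.Frobenioids.IsSlimGroup (profiniteCompletion G) := by
  obtain ⟨g, hg, ⟨e⟩⟩ := hG
  have hι := isProSigmaCompletion_comp_mulEquiv
    (IsProSigmaCompletion.isProSigmaCompletion_toCompletion G) e.symm
  refine IsProSigmaCompletion.isSlimGroup_of_oneRelator (α := Fin g ⊕ Fin g) ?_ (surfaceRelator g)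
    ⟨2, Nat.prime_two⟩ (fun _ hp => hp) ((toCompletion G).comp e.symm.toMonoidHom) hι
  simp only [Nat.card_eq_fintype_card, Fintype.card_sum, Fintype.card_fin]
  omega

/-- Slimness in use: in the profinite completion of an orientable surface group, an element commuting
with every element of an open subgroup is trivial. [cite: MochizukiAbsAnab2004, Lemma 1.3.1 p.15] -/
theorem eq_one_of_forall_mem_isOpen_commute (hG : IsOrientableSurfaceGroup G)
    (U : Subgroup (profiniteCompletion G)) (hU : IsOpen (U : Set (profiniteCompletion G)))
    {z : profiniteCompletion G} (hz : ∀ u ∈ U, u * z = z * u) : z = 1 := by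
  have h := (isSlimGroup_profiniteCompletion_of_surface G hG).centralizer_eq_bot U hU
  have hz' : z ∈ Subgroup.centralizer (U : Set (profiniteCompletion G)) :=
    Subgroup.mem_centralizer_iff.mpr hz
  rwa [h, Subgroup.mem_bot] at hz'

end Slim

end Literature.IUT.HodgeTheaters.ProfiniteCompletion
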